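import Literature.AlgebraicGeometry.Resolution.Lipman1969RationalContraction
import Literature.AlgebraicGeometry.Resolution.ExceptionalCurvePoints
import Summits.ResolutionOfSingularities.ResolutionOfSingularities.Theorems.HomologicalConductorNoZenoMinimalityDescent
import HarnessLib

/-!
# Crux `NoZenoR` (stmt-ResolutionOfSingularities-19943), facts slot `stub_publishedSurfaceFactsW3`:
# Lipman (27.3) «⇒» — A MINIMAL DESINGULARIZATION CARRIES NO EXCEPTIONAL CURVE OF THE FIRST KIND —
# from (27.1) ALONE

Route `ResolutionOfSingularities/HomologicalConductor` (cell decomp-res, hand leafhand-res-homologicalconduct-7 g0).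
OURS: AI-written bookkeeping, weaker than expert review; nothing here is a statement of the manuscript under review
(Hironaka 2017).  SUPPORT level, counted 0.  Def-free, no new named facts; FACT-PARAMETRIC in
`Literature.AlgebraicGeometry.Resolution.Lipman1969_27_1_reg_rat` only.

The registered text `Sig.FactsW3` of the by-name stub `stub_publishedSurfaceFactsW3` (v34, bb7eede791d68d16) carries BOTH
`Lipman1969_27_1_reg_rat` (Castelnuovo: rational contraction of exceptional curves of the first kind to regular points) and
`Lipman1969_27_3_rat` (`IsMinimalResolution π ↔ ∀ η, 3·h⁰(𝓘_η) < h⁰(𝓘_η²)`).  This file records that the «⇒» half of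
(27.3), in its qualitative form «no integral exceptional curve `E_η` of a MINIMAL desingularization is of the first kind,
`h⁰(𝓘_η²) ≠ 3·h⁰(𝓘_η)`», is a CONSEQUENCE of (27.1) and tree theorems, with a ten-line proof:

* (27.1) at `F = {η}` contracts `E_η = cl{η}` to a point of another desingularization `g : Y → Spec S`, by an `S`-morphism
  `h : X → Y` with `h⁻¹(h η) = cl{η}`;
* an `S`-morphism from a MINIMAL desingularization to a desingularization is an isomorphism (tree:
  `NoZeno.ExcCount.isIso_of_isMinimalResolution_of_fac`, over `IsResolution.eq_id_of_comp_eq`);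
* an isomorphism is injective on points, so `cl{η} = {η}` is closed and `height η = 0` (Mathlib
  `Scheme.height_of_isClosed`) — against `height η = 1` in the definition of `excCurvePoints`.

So, for the purpose of the «⇒» direction, (27.3) costs nothing beyond (27.1); the numerical sharpening
`3·h⁰(𝓘_η) < h⁰(𝓘_η²)` is supplied here under the separate inequality `3·h⁰(𝓘_η) ≤ h⁰(𝓘_η²)` ((13.1) a) + `(E²) < 0`, not
proved here), and the «⇐» direction of (27.3) (no first-kind curve ⇒ minimal; Lipman p. 277 via Theorem (4.1)'s factorisation
into quadratic transformations) is untouched.  No crux or summit statement is proved here.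
-/

noncomputable section

-- single-problem summit: the doubled namespace component `ResolutionOfSingularities` is forced
set_option linter.dupNamespace false

open CategoryTheory AlgebraicGeometry IsLocalRing
open Literature.AlgebraicGeometry.Resolution

universe u

namespace Summit.ResolutionOfSingularities.ResolutionOfSingularities.Theorems.NoZeno.ExcCount.MinimalNoFirstKind

variable {S : Type u} [CommRing S] [IsNoetherianRing S] [IsLocalRing S] [IsDomain S] [IsIntegrallyClosed S]
  {X : Scheme.{u}} {π : X ⟶ Spec (.of S)}

/-- **A contraction of a minimal desingularization contracts nothing.**  If `π : X → Spec S` is a MINIMAL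
desingularization, `g : Y → Spec S` a desingularization and `h : X → Y` an `S`-morphism (`h ≫ g = π`), then every fibre
`h⁻¹(h η)` is the single point `η` (`h` is an isomorphism: tree `isIso_of_isMinimalResolution_of_fac`). [folklore] -/
theorem preimage_singleton_eq_of_isMinimalResolution {Y : Scheme.{u}} {T : Scheme.{u}} {π : X ⟶ T} {g : Y ⟶ T}
    (hπ : IsMinimalResolution π) (hg : IsResolution g) (h : X ⟶ Y) (hh : h ≫ g = π) (η : X) :
    h.base ⁻¹' {h.base η} = {η} := by
  haveI : IsIso h := isIso_of_isMinimalResolution_of_fac hπ hg h hh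
  have hinj : Function.Injective h.base := (Scheme.homeoOfIso (asIso h)).injective
  rw [← Set.image_singleton, hinj.preimage_image]

/-- **Lipman (27.3) «⇒», qualitative form, FROM (27.1) ALONE: a minimal desingularization of a two-dimensional normal
Noetherian local domain with a rational singularity carries NO integral exceptional curve of the first kind** —
for every `η ∈ excCurvePoints π`, `h⁰(𝓘_η²) ≠ 3·h⁰(𝓘_η)`.  Proof: (27.1) at `F = {η}` gives a contraction `h : X → Y` onto
another desingularization with `h⁻¹(h η) = cl{η}`; `h` is an isomorphism (minimality), so `cl{η} = {η}` is closed and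
`height η = 0`, contradicting `height η = 1`.
[cite: Lipman1969, Theorem (27.1) (p. 275) and Corollary (27.3) (p. 277)] -/
theorem h0_sq_ne_three_mul_of_isMinimalResolution (h271 : Lipman1969_27_1_reg_rat.{u})
    (h2 : ringKrullDim S = 2) (hS : HasRationalSingularity S) (hπ : IsMinimalResolution π)
    {η : X} (hη : η ∈ excCurvePoints π) :
    h0 π (primeDivisorIdeal η ^ 2) ≠ 3 * h0 π (primeDivisorIdeal η) := by
  intro heq
  obtain ⟨Y, g, h, hc, hC, hfac, hg, hfib, -⟩ :=
    h271 S h2 hS X π hπ.1 {η} (Set.finite_singleton η) (Set.singleton_subset_iff.2 hη)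
      (fun a ha b hb hab => (hab ((Set.mem_singleton_iff.1 ha).trans (Set.mem_singleton_iff.1 hb).symm)).elim)
      (fun a ha => by rw [Set.mem_singleton_iff.1 ha]; exact heq)
  have hcl : closure ({η} : Set X) = {η} := by
    rw [← hfib η (Set.mem_singleton η)]
    exact preimage_singleton_eq_of_isMinimalResolution hπ hg h hfac η
  have hclosed : IsClosed ({η} : Set X) := closure_eq_iff_isClosed.1 hcl
  have h0' : Order.height η = 0 := Scheme.height_of_isClosed hclosed
  have h1 : Order.height η = 1 := hη.2
  rw [h0'] at h1
  exact zero_ne_one h1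

/-- **Lipman (27.3) «⇒» with the numerical sharpening supplied**: under the inequality `3·h⁰(𝓘_η) ≤ h⁰(𝓘_η²)` for the
integral exceptional curve `E_η` (i.e. `(E_η²) ≤ −h⁰(E_η)`: (13.1) a) with `(E_η²) < 0`, in the `h⁰`-dictionary of
`Lipman1969RationalContraction` — an input here, not proved), minimality gives the strict criterion (M)
`3·h⁰(𝓘_η) < h⁰(𝓘_η²)` of (27.3), from (27.1) alone. [cite: Lipman1969, Corollary (27.3) (p. 277)] -/
theorem three_mul_h0_lt_of_isMinimalResolution_of_le (h271 : Lipman1969_27_1_reg_rat.{u})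
    (h2 : ringKrullDim S = 2) (hS : HasRationalSingularity S) (hπ : IsMinimalResolution π)
    {η : X} (hη : η ∈ excCurvePoints π)
    (hle : 3 * h0 π (primeDivisorIdeal η) ≤ h0 π (primeDivisorIdeal η ^ 2)) :
    3 * h0 π (primeDivisorIdeal η) < h0 π (primeDivisorIdeal η ^ 2) :=
  lt_of_le_of_ne hle (h0_sq_ne_three_mul_of_isMinimalResolution h271 h2 hS hπ hη).symm

end Summit.ResolutionOfSingularities.ResolutionOfSingularities.Theorems.NoZeno.ExcCount.MinimalNoFirstKind

end
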